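import Summits.QuantumFields.BalabanUV.Beta.SecondOrderTransport

/-!
# `BalabanUV.Beta.SecondOrderContactForm` — binder row D1, W-side (L4), piece (W-X): through an2's second-order carrier, the nine-term
# `conjW` contact family of DIAGONAL product-chart generators assembles into the `conjW` contact of the DRESSED (coarse) letters; the mixed
# commutator family into the coarse commutator; and the ♯-response splits off ONE DISPLAYED RESIDUAL
# (β sub-cell, row BETA-an2 = BINDER-OWNERS row D1 OWNER, lineage an2 gen 17; sequel of `SecondOrderTransport`)

HONEST FRAMING (cell charter, verbatim): «discharging BetaPertH makes Balaban's UV stability UNCONDITIONAL — a real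
constructive-QFT result; it is NOT the continuum limit and NOT the Clay problem.»  HONEST DEPENDENCY (verbatim): «continuum YM on T⁴ ⇐
BetaPertH ∧ nine spine estimates (0/9 proved); BetaPertH ⇐ (D1) ∧ (D4) ∧ CAP+tail; G-an2-4 gates asym, D1 and NE2/3/4.»  DERIVED cell leaf:
[folklore] kernel algebra, ENTRYWISE (diagonal generators turn every composition into a pointwise product, `BorderedHessian.comp_diagK_left/right`)
plus linearity of absolutely convergent weighted sums; no statement of Bałaban's papers is typed here, no `[cite:]` tag, no `def`, no `Prop`
fact; it instantiates NO binder of the β-function wall.  NOT D1, NOT `BetaPertH`, NOT continuum, NOT Clay.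

## What and why

`SecondOrderTransport.W2OfK_bref_sharp` reduces the hR socket `hWrC` of `SpineRecursiveClosed.…_closed_bcj` for the (L4-D) literal to ONE
algebraic question: is `W2OfK K N S♯ M♯ S₂♯ M₂♯ − W2OfK K N S M S₂ M₂` of an5's form `conjW 𝕄 V V′ 𝒳 𝒳′ X₂`?  With the ♯-tables in the
SIMILARITY SHAPE of the product chart with DIAGONAL generators `X κ u = diagK (g κ u)` (the shape PROVED at first order —
`SpineRecursiveClosed.hSrC_SrecAt_all`, generator `γ • diagK (ctGen α κ u)`), i.e. `S♯ = S + conjV 𝕄 (X ·)`, `M♯ = M`,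
`S₂♯ κ u κ′ u′ = S₂ … + conjW 𝕄 (S κ u) (S κ′ u′) (X κ u) (X κ′ u′) (diagK (h κ u κ′ u′))`, `M₂♯ κ u ρ w = M₂ … + (M ρ w ∘ X κ u − X κ u ∘ M ρ w)`,
this file (part 1 of 2; part 2 = `SecondOrderContactResidual`: the mixed family, the `conjW₁`/`dM` assembly and the DISPLAYED response residual)
supplies the second-order-table identity the answer is made of:
* §1 entrywise calculus: `comp_diagK_diagK`, `conjW₁_diag_apply`, `conjW₂_diag_apply`, `conjW_swap`; weighted-sum linearity `tsum_lin3/4`,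
  `vertexOfK_add_of_summable`.
* §2 **`vertexOfK_conjW₁_diag`**, **`vertexOfK_conjW₂_diag`**, **`vertexOfK_conjW_diag`**: the chain-rule vertex of a conjW-family whose FIRST
  letter group `(T κ u, diagK (g κ u), diagK (h κ u))` varies and whose second group is fixed IS the conjW of the DRESSED letters
  `(vertexOfK K N T b, diagK (G b), diagK (H b))`, `G b = Σ_κ Σ'_u colH_b κ u · g κ u` (twin of `VertexReflectionContact.vertexOfK_conjV_diagK`);
  hence **`vertex2OfK_conjW_diag`**: THE BI-VERTEX OF THE NINE-TERM CONTACT FAMILY IS THE NINE-TERM CONTACT OF THE COARSE LETTERS,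
  `vertex2OfK K N (conjW-family) b c = conjW 𝕄 (vertexOfK K N S b) (vertexOfK K N S c) (diagK (G b)) (diagK (G c)) (diagK (H b c))`.
WHAT IS NOT HERE: the letters (W-0W)/(W-0B) (which ♯-bi-table the wall's `S₂` actually has); any `RelInv` manipulation; the residual (part 2).

Provenance: β sub-cell, unit beta-an2 gen 17, 2026-08-20 (v1); over `SecondOrderTransport` (an2), an5's `ChartConjugation`, an2's `DiagonalContact`,
an3's `VertexReflectionContact` — BY NAME; no existing file touched.
-/

noncomputable section

open Finset
open scoped BigOperators
open Literature.MathematicalPhysics.QuantumFieldTheory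
open Literature.MathematicalPhysics.QuantumFieldTheory.Balaban1983to89
open Literature.MathematicalPhysics.QuantumFieldTheory.Balaban1983to89.Beta
open ExpKernelCalculus (MKer comp)
open OneStepResolventKernel (Fib wsum)
open OneStepKernelFamily (colH vertexOfK)
open InterLevelTransport (cwsum cwsum_apply)
open SecondOrderResponse (colM vertexOfM dM K2OfK vertex2OfK mixOfK)
open Summit.QuantumFields.BalabanUV.Beta.TameKernelCalculus (Spr Loc Tame comp_add_right_tame comp_add_left_tame)
open Summit.QuantumFields.BalabanUV.Beta.ChartConjugation (conjV conjW conjW₁ conjW₂ loc_conjV)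
open Summit.QuantumFields.BalabanUV.Beta.BorderedHessian (diagK diagK_apply comp_diagK_right comp_diagK_left conjV_diagK_apply)
open Summit.QuantumFields.BalabanUV.Beta.VertexReflectionContact (vertexOfK_conjV_diagK tsum_mul_conjV_diagK)
open Summit.QuantumFields.BalabanUV.Beta.SecondOrderTransport (colH_smul vertexOfK_smul_kernel vertexOfM_smul_kernel)

namespace Summit.QuantumFields.BalabanUV.Beta.SecondOrderContactForm

variable {d N : ℕ}

/-! ## §1 Entrywise calculus of diagonal generators; weighted-sum linearity -/

section Diag

variable (g g' h : (Fin (d + 1) → ℤ) → Fib d → ℝ)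

/-- [folklore] Product of two diagonal kernels is the diagonal kernel of the product symbol. -/
theorem comp_diagK_diagK : comp (diagK g) (diagK g') = diagK (fun p a => g p a * g' p a) := by
  classical
  funext x z a b
  rw [comp_diagK_right, diagK_apply, diagK_apply]
  split_ifs with hxz
  · obtain ⟨rfl, rfl⟩ := hxz; rfl
  · rw [zero_mul]

/-- [folklore] **`conjW₁` OF DIAGONAL GENERATORS IS ENTRYWISE**: `conjW₁ V V′ (diagK g) (diagK g′) x z a b = V′·(g z b − g x a) + V·(g′ z b − g′ x a)`. -/
theorem conjW₁_diag_apply (V Vp : MKer (d + 1) (Fib d)) (x z : Fin (d + 1) → ℤ) (a b : Fib d) :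
    conjW₁ V Vp (diagK g) (diagK g') x z a b = Vp x z a b * (g z b - g x a) + V x z a b * (g' z b - g' x a) := by
  unfold ChartConjugation.conjW₁
  simp only [Pi.add_apply, Pi.sub_apply, comp_diagK_right, comp_diagK_left]
  ring

/-- [folklore] **`conjW₂` OF DIAGONAL GENERATORS IS ENTRYWISE**:
`conjW₂ 𝕄 (diagK g) (diagK g′) (diagK h) x z a b = 𝕄 x z a b · (2·g(x,a)·g′(x,a) − (g(x,a)·g′(z,b) + g′(x,a)·g(z,b)) + (h(z,b) − h(x,a)))`. -/
theorem conjW₂_diag_apply (M : MKer (d + 1) (Fib d)) (x z : Fin (d + 1) → ℤ) (a b : Fib d) :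
    conjW₂ M (diagK g) (diagK g') (diagK h) x z a b =
      M x z a b * (2 * (g x a * g' x a) - (g x a * g' z b + g' x a * g z b) + (h z b - h x a)) := by
  unfold ChartConjugation.conjW₂
  simp only [Pi.add_apply, Pi.sub_apply, comp_diagK_diagK, comp_diagK_right, comp_diagK_left]
  ring

end Diag

/-- [folklore] `conjW` is symmetric under the exchange of the two letter groups `(V, X) ↔ (V′, X′)`. -/
theorem conjW_swap {D : ℕ} {F : Type*} [Fintype F] (M V Vp X Xp X₂ : MKer D F) : conjW M V Vp X Xp X₂ = conjW M Vp V Xp X X₂ := by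
  unfold ChartConjugation.conjW ChartConjugation.conjW₁ ChartConjugation.conjW₂
  abel

section Lin

variable {w A B C D : (Fin (d + 1) → ℤ) → ℝ}

/-- [folklore] Linearity of a weighted sum against three summable families. -/
theorem tsum_lin3 (hA : Summable fun u => w u * A u) (hB : Summable fun u => w u * B u) (hC : Summable fun u => w u * C u)
    (α β γ : ℝ) : (∑' u, w u * (α * A u + β * B u + γ * C u)) =
      α * (∑' u, w u * A u) + β * (∑' u, w u * B u) + γ * (∑' u, w u * C u) := by
  have e : ∀ u, w u * (α * A u + β * B u + γ * C u) = α * (w u * A u) + β * (w u * B u) + γ * (w u * C u) := fun u => by ring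
  rw [tsum_congr e, ((hA.mul_left α).add (hB.mul_left β)).tsum_add (hC.mul_left γ), (hA.mul_left α).tsum_add (hB.mul_left β),
    tsum_mul_left, tsum_mul_left, tsum_mul_left]

/-- [folklore] Linearity of a weighted sum against four summable families. -/
theorem tsum_lin4 (hA : Summable fun u => w u * A u) (hB : Summable fun u => w u * B u) (hC : Summable fun u => w u * C u)
    (hD : Summable fun u => w u * D u) (α β γ δ : ℝ) : (∑' u, w u * (α * A u + β * B u + γ * C u + δ * D u)) =
      α * (∑' u, w u * A u) + β * (∑' u, w u * B u) + γ * (∑' u, w u * C u) + δ * (∑' u, w u * D u) := by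
  have e : ∀ u, w u * (α * A u + β * B u + γ * C u + δ * D u) =
      α * (w u * A u) + β * (w u * B u) + γ * (w u * C u) + δ * (w u * D u) := fun u => by ring
  rw [tsum_congr e, (((hA.mul_left α).add (hB.mul_left β)).add (hC.mul_left γ)).tsum_add (hD.mul_left δ),
    ((hA.mul_left α).add (hB.mul_left β)).tsum_add (hC.mul_left γ), (hA.mul_left α).tsum_add (hB.mul_left β),
    tsum_mul_left, tsum_mul_left, tsum_mul_left, tsum_mul_left]

end Lin

/-- [folklore] ADDITIVITY OF THE CHAIN-RULE VERTEX in the family slot, with the two entrywise summabilities as the only hypotheses. -/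
theorem vertexOfK_add_of_summable (K : MKer (d + 1) (Fib d)) {P Q : Fin (d + 1) → (Fin (d + 1) → ℤ) → MKer (d + 1) (Fib d)}
    (μ : Fin (d + 1)) (y : Fin (d + 1) → ℤ)
    (hP : ∀ (κ : Fin (d + 1)) (x z : Fin (d + 1) → ℤ) (a b : Fib d), Summable fun u => colH K N μ y κ u * P κ u x z a b)
    (hQ : ∀ (κ : Fin (d + 1)) (x z : Fin (d + 1) → ℤ) (a b : Fib d), Summable fun u => colH K N μ y κ u * Q κ u x z a b) :
    vertexOfK K N (fun κ u => P κ u + Q κ u) μ y = vertexOfK K N P μ y + vertexOfK K N Q μ y := by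
  funext x z a b
  simp only [vertexOfK, OneStepResolventKernel.wsum, Pi.add_apply, mul_add]
  rw [← Finset.sum_add_distrib]
  exact Finset.sum_congr rfl fun κ _ => (hP κ x z a b).tsum_add (hQ κ x z a b)

/-! ## §2 The chain-rule vertex of a conjW-family is the conjW of the dressed letters -/

section ConjW

variable (K 𝕄 : MKer (d + 1) (Fib d)) (N : ℕ)

/-- [folklore] **`conjW₁`-FAMILY, FIRST LETTER GROUP VARYING**: for families `T κ u` (kernels), `g κ u` (diagonal symbols) and fixed `V′`, `g′`,
`vertexOfK K N (κ u ↦ conjW₁ (T κ u) V′ (diagK (g κ u)) (diagK g′)) b = conjW₁ (vertexOfK K N T b) V′ (diagK (G b)) (diagK g′)`,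
`G b p c = Σ_κ Σ'_u colH K N b κ u · g κ u p c`. -/
theorem vertexOfK_conjW₁_diag {T : Fin (d + 1) → (Fin (d + 1) → ℤ) → MKer (d + 1) (Fib d)}
    {g : Fin (d + 1) → (Fin (d + 1) → ℤ) → (Fin (d + 1) → ℤ) → Fib d → ℝ} (Vp : MKer (d + 1) (Fib d)) (g' : (Fin (d + 1) → ℤ) → Fib d → ℝ)
    (μ : Fin (d + 1)) (y : Fin (d + 1) → ℤ)
    (hT : ∀ (κ : Fin (d + 1)) (x z : Fin (d + 1) → ℤ) (a b : Fib d), Summable fun u => colH K N μ y κ u * T κ u x z a b)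
    (hg : ∀ (κ : Fin (d + 1)) (p : Fin (d + 1) → ℤ) (c : Fib d), Summable fun u => colH K N μ y κ u * g κ u p c) :
    vertexOfK K N (fun κ u => conjW₁ (T κ u) Vp (diagK (g κ u)) (diagK g')) μ y =
      conjW₁ (vertexOfK K N T μ y) Vp (diagK fun p c => ∑ κ, ∑' u, colH K N μ y κ u * g κ u p c) (diagK g') := by
  funext x z a b
  rw [conjW₁_diag_apply]
  simp only [vertexOfK, OneStepResolventKernel.wsum, conjW₁_diag_apply]
  have e : ∀ (κ : Fin (d + 1)) (u : Fin (d + 1) → ℤ), colH K N μ y κ u * (Vp x z a b * (g κ u z b - g κ u x a) + T κ u x z a b * (g' z b - g' x a)) =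
      colH K N μ y κ u * ((g' z b - g' x a) * T κ u x z a b + Vp x z a b * g κ u z b + (-Vp x z a b) * g κ u x a) := fun κ u => by ring
  have hκ : ∀ κ : Fin (d + 1), (∑' u, colH K N μ y κ u * (Vp x z a b * (g κ u z b - g κ u x a) + T κ u x z a b * (g' z b - g' x a))) =
      (g' z b - g' x a) * (∑' u, colH K N μ y κ u * T κ u x z a b) + Vp x z a b * (∑' u, colH K N μ y κ u * g κ u z b) +
        (-Vp x z a b) * (∑' u, colH K N μ y κ u * g κ u x a) := fun κ => by
    rw [tsum_congr (e κ)]; exact tsum_lin3 (hT κ x z a b) (hg κ z b) (hg κ x a) _ _ _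
  rw [Finset.sum_congr rfl fun κ _ => hκ κ]
  simp only [Finset.sum_add_distrib, ← Finset.mul_sum]
  ring

/-- [folklore] **`conjW₂`-FAMILY, FIRST GENERATOR VARYING**: for symbol families `g κ u`, `h κ u` and fixed `g′`,
`vertexOfK K N (κ u ↦ conjW₂ 𝕄 (diagK (g κ u)) (diagK g′) (diagK (h κ u))) b = conjW₂ 𝕄 (diagK (G b)) (diagK g′) (diagK (H b))`. -/
theorem vertexOfK_conjW₂_diag {g h : Fin (d + 1) → (Fin (d + 1) → ℤ) → (Fin (d + 1) → ℤ) → Fib d → ℝ}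
    (g' : (Fin (d + 1) → ℤ) → Fib d → ℝ) (μ : Fin (d + 1)) (y : Fin (d + 1) → ℤ)
    (hg : ∀ (κ : Fin (d + 1)) (p : Fin (d + 1) → ℤ) (c : Fib d), Summable fun u => colH K N μ y κ u * g κ u p c)
    (hh : ∀ (κ : Fin (d + 1)) (p : Fin (d + 1) → ℤ) (c : Fib d), Summable fun u => colH K N μ y κ u * h κ u p c) :
    vertexOfK K N (fun κ u => conjW₂ 𝕄 (diagK (g κ u)) (diagK g') (diagK (h κ u))) μ y =
      conjW₂ 𝕄 (diagK fun p c => ∑ κ, ∑' u, colH K N μ y κ u * g κ u p c) (diagK g')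
        (diagK fun p c => ∑ κ, ∑' u, colH K N μ y κ u * h κ u p c) := by
  funext x z a b
  rw [conjW₂_diag_apply]
  simp only [vertexOfK, OneStepResolventKernel.wsum, conjW₂_diag_apply]
  have e : ∀ (κ : Fin (d + 1)) (u : Fin (d + 1) → ℤ), colH K N μ y κ u *
      (𝕄 x z a b * (2 * (g κ u x a * g' x a) - (g κ u x a * g' z b + g' x a * g κ u z b) + (h κ u z b - h κ u x a))) =
      colH K N μ y κ u * ((𝕄 x z a b * (2 * g' x a - g' z b)) * g κ u x a + (-(𝕄 x z a b * g' x a)) * g κ u z b +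
        𝕄 x z a b * h κ u z b + (-𝕄 x z a b) * h κ u x a) := fun κ u => by ring
  have hκ : ∀ κ : Fin (d + 1), (∑' u, colH K N μ y κ u *
      (𝕄 x z a b * (2 * (g κ u x a * g' x a) - (g κ u x a * g' z b + g' x a * g κ u z b) + (h κ u z b - h κ u x a)))) =
      (𝕄 x z a b * (2 * g' x a - g' z b)) * (∑' u, colH K N μ y κ u * g κ u x a) + (-(𝕄 x z a b * g' x a)) * (∑' u, colH K N μ y κ u * g κ u z b) +
        𝕄 x z a b * (∑' u, colH K N μ y κ u * h κ u z b) + (-𝕄 x z a b) * (∑' u, colH K N μ y κ u * h κ u x a) := fun κ => by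
    rw [tsum_congr (e κ)]; exact tsum_lin4 (hg κ x a) (hg κ z b) (hh κ z b) (hh κ x a) _ _ _ _
  rw [Finset.sum_congr rfl fun κ _ => hκ κ]
  simp only [Finset.sum_add_distrib, ← Finset.mul_sum]
  ring

/-- [folklore] Entrywise summability of the conjW₁-family against the column weights (a linear combination of the letter summabilities). -/
theorem summable_colH_conjW₁_diag {T : Fin (d + 1) → (Fin (d + 1) → ℤ) → MKer (d + 1) (Fib d)}
    {g : Fin (d + 1) → (Fin (d + 1) → ℤ) → (Fin (d + 1) → ℤ) → Fib d → ℝ} (Vp : MKer (d + 1) (Fib d)) (g' : (Fin (d + 1) → ℤ) → Fib d → ℝ)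
    (μ : Fin (d + 1)) (y : Fin (d + 1) → ℤ)
    (hT : ∀ (κ : Fin (d + 1)) (x z : Fin (d + 1) → ℤ) (a b : Fib d), Summable fun u => colH K N μ y κ u * T κ u x z a b)
    (hg : ∀ (κ : Fin (d + 1)) (p : Fin (d + 1) → ℤ) (c : Fib d), Summable fun u => colH K N μ y κ u * g κ u p c)
    (κ : Fin (d + 1)) (x z : Fin (d + 1) → ℤ) (a b : Fib d) :
    Summable fun u => colH K N μ y κ u * conjW₁ (T κ u) Vp (diagK (g κ u)) (diagK g') x z a b := by
  have e : ∀ u, colH K N μ y κ u * conjW₁ (T κ u) Vp (diagK (g κ u)) (diagK g') x z a b =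
      (g' z b - g' x a) * (colH K N μ y κ u * T κ u x z a b) + Vp x z a b * (colH K N μ y κ u * g κ u z b) -
        Vp x z a b * (colH K N μ y κ u * g κ u x a) := fun u => by rw [conjW₁_diag_apply]; ring
  exact (((((hT κ x z a b).mul_left _).add ((hg κ z b).mul_left _)).sub ((hg κ x a).mul_left _))).congr fun u => (e u).symm

/-- [folklore] Entrywise summability of the conjW₂-family against the column weights. -/
theorem summable_colH_conjW₂_diag {g h : Fin (d + 1) → (Fin (d + 1) → ℤ) → (Fin (d + 1) → ℤ) → Fib d → ℝ}
    (g' : (Fin (d + 1) → ℤ) → Fib d → ℝ) (μ : Fin (d + 1)) (y : Fin (d + 1) → ℤ)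
    (hg : ∀ (κ : Fin (d + 1)) (p : Fin (d + 1) → ℤ) (c : Fib d), Summable fun u => colH K N μ y κ u * g κ u p c)
    (hh : ∀ (κ : Fin (d + 1)) (p : Fin (d + 1) → ℤ) (c : Fib d), Summable fun u => colH K N μ y κ u * h κ u p c)
    (κ : Fin (d + 1)) (x z : Fin (d + 1) → ℤ) (a b : Fib d) :
    Summable fun u => colH K N μ y κ u * conjW₂ 𝕄 (diagK (g κ u)) (diagK g') (diagK (h κ u)) x z a b := by
  have e : ∀ u, colH K N μ y κ u * conjW₂ 𝕄 (diagK (g κ u)) (diagK g') (diagK (h κ u)) x z a b =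
      (𝕄 x z a b * (2 * g' x a - g' z b)) * (colH K N μ y κ u * g κ u x a) - (𝕄 x z a b * g' x a) * (colH K N μ y κ u * g κ u z b) +
        𝕄 x z a b * (colH K N μ y κ u * h κ u z b) - 𝕄 x z a b * (colH K N μ y κ u * h κ u x a) := fun u => by
    rw [conjW₂_diag_apply]; ring
  exact ((((((hg κ x a).mul_left _).sub ((hg κ z b).mul_left _)).add ((hh κ z b).mul_left _)).sub ((hh κ x a).mul_left _))).congr
    fun u => (e u).symm

/-- [folklore] **`conjW`-FAMILY, FIRST LETTER GROUP VARYING**: the chain-rule vertex of `κ u ↦ conjW 𝕄 (T κ u) V′ (diagK (g κ u)) (diagK g′) (diagK (h κ u))`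
IS `conjW 𝕄 (vertexOfK K N T b) V′ (diagK (G b)) (diagK g′) (diagK (H b))` with the DRESSED symbols `G`, `H`. -/
theorem vertexOfK_conjW_diag {T : Fin (d + 1) → (Fin (d + 1) → ℤ) → MKer (d + 1) (Fib d)}
    {g h : Fin (d + 1) → (Fin (d + 1) → ℤ) → (Fin (d + 1) → ℤ) → Fib d → ℝ} (Vp : MKer (d + 1) (Fib d)) (g' : (Fin (d + 1) → ℤ) → Fib d → ℝ)
    (μ : Fin (d + 1)) (y : Fin (d + 1) → ℤ)
    (hT : ∀ (κ : Fin (d + 1)) (x z : Fin (d + 1) → ℤ) (a b : Fib d), Summable fun u => colH K N μ y κ u * T κ u x z a b)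
    (hg : ∀ (κ : Fin (d + 1)) (p : Fin (d + 1) → ℤ) (c : Fib d), Summable fun u => colH K N μ y κ u * g κ u p c)
    (hh : ∀ (κ : Fin (d + 1)) (p : Fin (d + 1) → ℤ) (c : Fib d), Summable fun u => colH K N μ y κ u * h κ u p c) :
    vertexOfK K N (fun κ u => conjW 𝕄 (T κ u) Vp (diagK (g κ u)) (diagK g') (diagK (h κ u))) μ y =
      conjW 𝕄 (vertexOfK K N T μ y) Vp (diagK fun p c => ∑ κ, ∑' u, colH K N μ y κ u * g κ u p c) (diagK g')
        (diagK fun p c => ∑ κ, ∑' u, colH K N μ y κ u * h κ u p c) := by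
  unfold ChartConjugation.conjW
  rw [vertexOfK_add_of_summable K μ y (summable_colH_conjW₁_diag K N Vp g' μ y hT hg) (summable_colH_conjW₂_diag K 𝕄 N g' μ y hg hh),
    vertexOfK_conjW₁_diag K N Vp g' μ y hT hg, vertexOfK_conjW₂_diag K 𝕄 N g' μ y hg hh]

/-- [folklore] **THE BI-VERTEX OF THE NINE-TERM CONTACT FAMILY IS THE NINE-TERM CONTACT OF THE COARSE LETTERS**: for a field table `S`,
diagonal generator symbols `g κ u` and second symbols `h κ u κ′ u′`, with the inner- and outer-slot summabilities as the only hypotheses,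
`vertex2OfK K N (κ u κ′ u′ ↦ conjW 𝕄 (S κ u) (S κ′ u′) (diagK (g κ u)) (diagK (g κ′ u′)) (diagK (h κ u κ′ u′))) μ y ν y′
 = conjW 𝕄 (vertexOfK K N S μ y) (vertexOfK K N S ν y′) (diagK (G μ y)) (diagK (G ν y′)) (diagK (H μ y ν y′))`,
`G b = Σ colH_b · g`, `H b c = Σ_κ Σ'_u colH_b κ u · (Σ_κ′ Σ'_u′ colH_c κ′ u′ · h κ u κ′ u′)`. -/
theorem vertex2OfK_conjW_diag {S : Fin (d + 1) → (Fin (d + 1) → ℤ) → MKer (d + 1) (Fib d)}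
    {g : Fin (d + 1) → (Fin (d + 1) → ℤ) → (Fin (d + 1) → ℤ) → Fib d → ℝ}
    {h : Fin (d + 1) → (Fin (d + 1) → ℤ) → Fin (d + 1) → (Fin (d + 1) → ℤ) → (Fin (d + 1) → ℤ) → Fib d → ℝ}
    (μ : Fin (d + 1)) (y : Fin (d + 1) → ℤ) (ν : Fin (d + 1)) (y' : Fin (d + 1) → ℤ)
    (hS : ∀ (μ : Fin (d + 1)) (y : Fin (d + 1) → ℤ) (κ : Fin (d + 1)) (x z : Fin (d + 1) → ℤ) (a b : Fib d),
      Summable fun u => colH K N μ y κ u * S κ u x z a b)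
    (hg : ∀ (μ : Fin (d + 1)) (y : Fin (d + 1) → ℤ) (κ : Fin (d + 1)) (p : Fin (d + 1) → ℤ) (c : Fib d),
      Summable fun u => colH K N μ y κ u * g κ u p c)
    (hhin : ∀ (κ : Fin (d + 1)) (u : Fin (d + 1) → ℤ) (κ' : Fin (d + 1)) (p : Fin (d + 1) → ℤ) (c : Fib d),
      Summable fun u' => colH K N ν y' κ' u' * h κ u κ' u' p c)
    (hhout : ∀ (κ : Fin (d + 1)) (p : Fin (d + 1) → ℤ) (c : Fib d),
      Summable fun u => colH K N μ y κ u * ∑ κ', ∑' u', colH K N ν y' κ' u' * h κ u κ' u' p c) :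
    vertex2OfK K N (fun κ u κ' u' => conjW 𝕄 (S κ u) (S κ' u') (diagK (g κ u)) (diagK (g κ' u')) (diagK (h κ u κ' u'))) μ y ν y' =
      conjW 𝕄 (vertexOfK K N S μ y) (vertexOfK K N S ν y') (diagK fun p c => ∑ κ, ∑' u, colH K N μ y κ u * g κ u p c)
        (diagK fun p c => ∑ κ', ∑' u', colH K N ν y' κ' u' * g κ' u' p c)
        (diagK fun p c => ∑ κ, ∑' u, colH K N μ y κ u * ∑ κ', ∑' u', colH K N ν y' κ' u' * h κ u κ' u' p c) := by
  -- inner slot: swap the letter groups so that the varying group comes first, apply `vertexOfK_conjW_diag`, swap back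
  have hin : ∀ (κ : Fin (d + 1)) (u : Fin (d + 1) → ℤ),
      vertexOfK K N (fun κ' u' => conjW 𝕄 (S κ u) (S κ' u') (diagK (g κ u)) (diagK (g κ' u')) (diagK (h κ u κ' u'))) ν y' =
        conjW 𝕄 (S κ u) (vertexOfK K N S ν y') (diagK (g κ u)) (diagK fun p c => ∑ κ', ∑' u', colH K N ν y' κ' u' * g κ' u' p c)
          (diagK fun p c => ∑ κ', ∑' u', colH K N ν y' κ' u' * h κ u κ' u' p c) := by
    intro κ u
    have e : (fun κ' u' => conjW 𝕄 (S κ u) (S κ' u') (diagK (g κ u)) (diagK (g κ' u')) (diagK (h κ u κ' u'))) =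
        fun κ' u' => conjW 𝕄 (S κ' u') (S κ u) (diagK (g κ' u')) (diagK (g κ u)) (diagK (h κ u κ' u')) := by
      funext κ' u'; exact conjW_swap _ _ _ _ _ _
    rw [e, vertexOfK_conjW_diag K 𝕄 N (S κ u) (g κ u) ν y' (hS ν y') (hg ν y') (hhin κ u), conjW_swap]
  -- outer slot
  show vertexOfK K N (fun κ u => vertexOfK K N
      (fun κ' u' => conjW 𝕄 (S κ u) (S κ' u') (diagK (g κ u)) (diagK (g κ' u')) (diagK (h κ u κ' u'))) ν y') μ y = _
  simp_rw [hin]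
  exact vertexOfK_conjW_diag K 𝕄 N (vertexOfK K N S ν y') _ μ y (hS μ y) (hg μ y) hhout

end ConjW

end Summit.QuantumFields.BalabanUV.Beta.SecondOrderContactForm

end
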